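import Mathlib.NumberTheory.Chebyshev
import Mathlib.Algebra.Order.Chebyshev
import Mathlib.Analysis.MeanInequalitiesPow
import Mathlib.Analysis.SpecialFunctions.Pow.Asymptotics
import Mathlib.MeasureTheory.Integral.IntervalIntegral.Basic
import Literature.NumberTheory.LFunctions.HalaszRestrictedShortMeanSquare
import Literature.NumberTheory.LFunctions.PrimeCountingShortIntervalTransfer
import Literature.NumberTheory.LFunctions.GuthMaynardPrimeCorollaries
import HarnessLib

/-!
# Guth–Maynard, Corollary 1.4 (primes in almost all short intervals) from the `ψ` mean square

NOT RH-BEARING (D-0040; bears_on: LADDER-RH §4 HELD row `DensityLadder`, stmt-19600): a density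
estimate counts zeros off the critical line, it never empties the strip (Barrier
`Literature.Barriers.RiemannHypothesis.LindelofBacklund`); Corollary 1.4 is a statement about PRIMES
in almost all short intervals, RH-free literature. WHAT THIS IS NOT: nothing in this file is worded
as, or bears on, the truth of RH.

Source: L. Guth, J. Maynard, *New large value estimates for Dirichlet polynomials*, Ann. of Math. (2)
203 (2026) 623–675 (= arXiv:2405.20552), Corollary 1.4 (statement: arXiv p. 3, corpus chunk
p0003:L72) and the second half of §13.2 (chunk p0029:L55–L62; its deduction from the mean-square
estimate (AlmostAllTarget)):

> For Corollary 1.4, we first let `δ = X^{-13/15+ε/2}`. By splitting `[x, x+y]` into intervals of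
> length `δx` and applying Cauchy–Schwarz, we see that
> `∫_X^{2X} (Σ_{n ∈ [x,x+y]} Λ(n) − y)² dx ≪ (y²/(δ²X²)) ∫_X^{3X} (Σ_{n ∈ [x,x+δx]} Λ(n) − δx)² dx + O(δ²X³)`.
> If the corollary was false, the left hand side would be significantly larger than
> `y² X exp(−3 (log X)^{1/4})`, so it suffices to show that the integral on the right hand side is
> `≪ δ² X³ exp(−3 (log X)^{1/4})`.

## Contents (all PROVED; no named fact is introduced)

* §1 `telescope_mul_windows`, `abs_window_le_sum_mul_windows`, `sq_window_le_sum_mul_windows` —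
  the splitting of `[u, u+y]` into multiplicative `δ`-windows `[v, v(1+δ)]` and Cauchy–Schwarz
  (pointwise in `u`; the last incomplete window is absorbed by monotonicity of `ψ`, the printed
  `O(δ²X³)`).
* §2 interval integrability of the squared window functions (bounded and measurable).
* §3 `threshold_sq_le_sum_integral`, `card_exceptional_mul_le` — Chebyshev's inequality over the
  integers `n ∈ [X, 2X]` with `|ψ(n+y) − ψ(n) − y| > E` ("if the corollary was false, the left hand
  side would be significantly larger"): on `(n, n+1)` the window function changes by at most one
  `Λ`-value, so each exceptional integer contributes `≥ E²/4` to the mean square; then the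
  substitution `v = u(1+δ)^j` lands in `[X, 3X]`.
* §4 `abs_pi_window_le_of_abs_psi_le` — the `ψ → π` transfer ("by partial summation") in the form
  needed here, CITED from `PrimeWindow.abs_primeCounting_window_sub_le_of_abs_psi_le_sharp`
  (`PrimeCountingShortIntervalTransfer.lean`).
* §5 growth lemmas (`exp((log 2X)^{1/4}) ≪ X^η`, `log² X ≪ X^η`).
* §6 `window_bookkeeping`, `count_bookkeeping` and the target
  `GuthMaynardAlmostAll.corollary_1_4_of_psiMeanSquareShort :
    GuthMaynard2026_psiMeanSquareShort → GuthMaynard2026_corollary_1_4`,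
  re-exported as `GuthMaynard2026_corollary_1_4_of_psiMeanSquareShort`.

## Constants and design choices

The mean square `GuthMaynard2026_psiMeanSquareShort` (C0 file `GuthMaynardPrimeCorollaries.lean`) is
used with the PRINTED exponent `A = 3` and `δ = X^{-13/15+ε/2}` (range parameter `ε/2`), on `[X, 3X]`.
The `ψ`-level exceptional threshold is `E₀ = y exp(−(log 2X)^{1/4})` (uniform in `x ∈ [X, 2X]`); the
number `K` of `δ`-windows is the least `K` with `(1+δ)^K > 1 + y/X` (so `K ≤ y/(δX) + 1` by Bernoulli
and `(2X+1)(1+δ)^K ≤ 3X`). Output constants: `C = 3` (threshold `3 y exp(−(log x)^{1/4})`) and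
`K = 64 e² max(C_ms, 1)` where `C_ms` is the mean-square constant; the count is
`≤ 64 e² C_ms X exp(−(log X)^{1/4})` because `A = 3` beats the `exp(2 (log 2X)^{1/4})` lost in
Chebyshev and `(log 2X)^{1/4} ≤ (log X)^{1/4} + 1`. `Chebyshev.psi` (Mathlib) is the `ψ` of the source
("the Von Mangoldt function in place of the prime indicator function"); `π(u) = Nat.primeCounting ⌊u⌋₊`.

Deliberately NOT here: the mean-square estimate itself (§13.2 (d), explicit formula and zero-density
input; C3 file `GuthMaynardPsiMeanSquareProofs.lean`) and the near-`σ = 1` density input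
(`ZeroDensityNearOne*.lean`); the unconditional `GuthMaynard2026_corollary_1_4_holds` is the one-line
composition of those with `GuthMaynard2026_corollary_1_4_of_psiMeanSquareShort`, appended when they
land.

## References

* L. Guth, J. Maynard, *New large value estimates for Dirichlet polynomials*, Ann. of Math. (2) 203
  (2026), no. 2, 623–675, doi:10.4007/annals.2026.203.2.6; arXiv:2405.20552. Corollary 1.4, §13.2.
  [bib: GuthMaynard2026]
-/

noncomputable section

open Real Finset MeasureTheory Set
open scoped Chebyshev Nat.Prime Interval

namespace Literature.NumberTheory.LFunctions

namespace GuthMaynardAlmostAll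

/-! ### §1. Splitting a window `[u, u+y]` into multiplicative `δ`-windows -/

/-- Telescoping over multiplicative windows (any real `c`):
`ψ(u cᵏ) − ψ(u) − (u cᵏ − u) = Σ_{j<k} (ψ(u cʲ c) − ψ(u cʲ) − (c − 1) u cʲ)`.
[cite: GuthMaynard2026, §13.2 (proof of Cor. 1.4, "splitting [x,x+y] into intervals of length δx")] -/
theorem telescope_mul_windows (u c : ℝ) (k : ℕ) :
    ψ (u * c ^ k) - ψ u - (u * c ^ k - u) =
      ∑ j ∈ Finset.range k, (ψ (u * c ^ j * c) - ψ (u * c ^ j) - (c - 1) * (u * c ^ j)) := by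
  induction k with
  | zero => simp
  | succ k ih =>
    rw [Finset.sum_range_succ, ← ih, pow_succ, ← mul_assoc]
    ring

/-- **Pointwise splitting bound** (Guth–Maynard §13.2, "splitting `[x, x+y]` into intervals of
length `δx`"): if `u > 0`, `y > 0`, `δ > 0` and `u (1+δ)^K > u + y`, then
`|ψ(u+y) − ψ(u) − y| ≤ Σ_{j<K} |ψ(u(1+δ)ʲ(1+δ)) − ψ(u(1+δ)ʲ) − δ u (1+δ)ʲ| + δ (u + y)`
(the last, incomplete window is absorbed using the monotonicity of `ψ`).
[cite: GuthMaynard2026, §13.2 (proof of Corollary 1.4)] -/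
theorem abs_window_le_sum_mul_windows {u y δ : ℝ} {K : ℕ} (hu : 0 < u) (hy : 0 < y)
    (hδ : 0 < δ) (hK : u + y < u * (1 + δ) ^ K) :
    |ψ (u + y) - ψ u - y| ≤
      (∑ j ∈ Finset.range K,
          |ψ (u * (1 + δ) ^ j * (1 + δ)) - ψ (u * (1 + δ) ^ j) - δ * (u * (1 + δ) ^ j)|) +
        δ * (u + y) := by
  classical
  have hex : ∃ j : ℕ, u + y < u * (1 + δ) ^ j := ⟨K, hK⟩
  have hmK : Nat.find hex ≤ K := Nat.find_le hK
  have hm_spec : u + y < u * (1 + δ) ^ (Nat.find hex) := Nat.find_spec hex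
  have hm0 : Nat.find hex ≠ 0 := by
    intro h0
    rw [h0, pow_zero, mul_one] at hm_spec
    linarith
  obtain ⟨k, hk⟩ := Nat.exists_eq_succ_of_ne_zero hm0
  rw [hk] at hmK hm_spec
  have hk_le : u * (1 + δ) ^ k ≤ u + y := by
    have := Nat.find_min hex (show k < Nat.find hex by omega)
    exact not_lt.1 this
  set c : ℝ := 1 + δ with hc
  have hc1 : 1 ≤ c := by rw [hc]; linarith
  have hc0 : 0 < c := by linarith
  -- the three pieces
  have htel := telescope_mul_windows u c k
  have hcm1 : c - 1 = δ := by rw [hc]; ring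
  rw [hcm1] at htel
  -- piece 2: `0 ≤ ψ(u+y) − ψ(u cᵏ) ≤ ψ(u cᵏ c) − ψ(u cᵏ)`
  have h2lo : 0 ≤ ψ (u + y) - ψ (u * c ^ k) := sub_nonneg.2 (Chebyshev.psi_mono hk_le)
  have h2hi : ψ (u + y) - ψ (u * c ^ k) ≤ ψ (u * c ^ k * c) - ψ (u * c ^ k) := by
    have : ψ (u + y) ≤ ψ (u * c ^ k * c) := by
      refine Chebyshev.psi_mono ?_
      rw [mul_assoc, ← pow_succ]; exact hm_spec.le
    linarith
  -- piece 3: `0 ≤ (u + y) − u cᵏ ≤ δ (u + y)`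
  have h3lo : 0 ≤ (u + y) - u * c ^ k := sub_nonneg.2 hk_le
  have h3hi : (u + y) - u * c ^ k ≤ δ * (u + y) := by
    have h' : u + y < u * c ^ k * c := by rw [mul_assoc, ← pow_succ]; exact hm_spec
    have hck : 0 ≤ u * c ^ k := by positivity
    rw [hc] at h'
    nlinarith
  -- assemble
  set g : ℕ → ℝ := fun j => ψ (u * c ^ j * c) - ψ (u * c ^ j) - δ * (u * c ^ j) with hg
  have hsum_abs : |∑ j ∈ Finset.range k, g j| ≤ ∑ j ∈ Finset.range k, |g j| :=
    Finset.abs_sum_le_sum_abs _ _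
  have hsub : ∑ j ∈ Finset.range (k + 1), |g j| ≤ ∑ j ∈ Finset.range K, |g j| :=
    Finset.sum_le_sum_of_subset_of_nonneg (Finset.range_subset_range.2 (by omega))
      (fun _ _ _ => abs_nonneg _)
  rw [Finset.sum_range_succ] at hsub
  have hF : ψ (u + y) - ψ u - y =
      (∑ j ∈ Finset.range k, g j) + (ψ (u + y) - ψ (u * c ^ k)) - ((u + y) - u * c ^ k) := by
    rw [hg, ← htel]; ring
  have hgoal : (∑ j ∈ Finset.range K,
      |ψ (u * c ^ j * c) - ψ (u * c ^ j) - δ * (u * c ^ j)|) = ∑ j ∈ Finset.range K, |g j| := by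
    simp only [hg]
  rw [hF, hgoal, abs_le]
  have hgk : ψ (u * c ^ k * c) - ψ (u * c ^ k) = g k + δ * (u * c ^ k) := by
    simp only [hg]; ring
  have hδuck : δ * (u * c ^ k) ≤ δ * (u + y) := mul_le_mul_of_nonneg_left hk_le hδ.le
  have habs1 := neg_abs_le (∑ j ∈ Finset.range k, g j)
  have habs2 := le_abs_self (∑ j ∈ Finset.range k, g j)
  have habs3 := le_abs_self (g k)
  have habs4 := abs_nonneg (g k)
  constructor <;> linarith

/-- Squared form of `abs_window_le_sum_mul_windows` via Cauchy–Schwarz: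
`(ψ(u+y) − ψ(u) − y)² ≤ 2K Σ_{j<K} (ψ(u(1+δ)ʲ(1+δ)) − ψ(u(1+δ)ʲ) − δu(1+δ)ʲ)² + 2δ²(u+y)²`.
[cite: GuthMaynard2026, §13.2 (proof of Corollary 1.4, Cauchy–Schwarz step)] -/
theorem sq_window_le_sum_mul_windows {u y δ : ℝ} {K : ℕ} (hu : 0 < u) (hy : 0 < y)
    (hδ : 0 < δ) (hK : u + y < u * (1 + δ) ^ K) :
    (ψ (u + y) - ψ u - y) ^ 2 ≤
      2 * K * (∑ j ∈ Finset.range K,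
          (ψ (u * (1 + δ) ^ j * (1 + δ)) - ψ (u * (1 + δ) ^ j) - δ * (u * (1 + δ) ^ j)) ^ 2) +
        2 * (δ * (u + y)) ^ 2 := by
  have h := abs_window_le_sum_mul_windows hu hy hδ hK
  set S := ∑ j ∈ Finset.range K,
      |ψ (u * (1 + δ) ^ j * (1 + δ)) - ψ (u * (1 + δ) ^ j) - δ * (u * (1 + δ) ^ j)| with hS
  have hS0 : 0 ≤ S := Finset.sum_nonneg fun _ _ => abs_nonneg _
  have hR0 : 0 ≤ δ * (u + y) := by positivity
  have hCS : S ^ 2 ≤ K * ∑ j ∈ Finset.range K,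
      (ψ (u * (1 + δ) ^ j * (1 + δ)) - ψ (u * (1 + δ) ^ j) - δ * (u * (1 + δ) ^ j)) ^ 2 := by
    have := sq_sum_le_card_mul_sum_sq (s := Finset.range K)
      (f := fun j => |ψ (u * (1 + δ) ^ j * (1 + δ)) - ψ (u * (1 + δ) ^ j) - δ * (u * (1 + δ) ^ j)|)
    simp only [Finset.card_range, sq_abs] at this
    exact this
  have hsq : (ψ (u + y) - ψ u - y) ^ 2 ≤ (S + δ * (u + y)) ^ 2 := by
    have h0 : 0 ≤ S + δ * (u + y) := by positivity
    calc (ψ (u + y) - ψ u - y) ^ 2 = |ψ (u + y) - ψ u - y| ^ 2 := (sq_abs _).symm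
      _ ≤ (S + δ * (u + y)) ^ 2 := pow_le_pow_left₀ (abs_nonneg _) h 2
  have h2 : (S + δ * (u + y)) ^ 2 ≤ 2 * S ^ 2 + 2 * (δ * (u + y)) ^ 2 := by
    nlinarith [sq_nonneg (S - δ * (u + y))]
  nlinarith


/-! ### §2. Integrability of the window functions -/

/-- `ψ` is Borel measurable (it is monotone). [folklore] -/
private theorem measurable_psi : Measurable ψ := Chebyshev.psi_mono.measurable

/-- A measurable real function bounded on `Ι a b` is interval integrable on `[a, b]`. [folklore] -/
private theorem intervalIntegrable_of_abs_le {G : ℝ → ℝ} {a b M : ℝ} (hG : Measurable G)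
    (hM : ∀ u ∈ Ι a b, |G u| ≤ M) : IntervalIntegrable G volume a b := by
  refine (intervalIntegrable_const (c := M)).mono_fun hG.aestronglyMeasurable ?_
  rw [Filter.EventuallyLE, ae_restrict_iff' measurableSet_uIoc]
  refine Filter.Eventually.of_forall fun u hu => ?_
  rw [Real.norm_eq_abs, Real.norm_eq_abs]
  exact (hM u hu).trans (le_abs_self M)

/-- The squared multiplicative-window function `u ↦ (ψ(u a c) − ψ(u a) − δ u a)²` (`a, c ≥ 0`) is
interval integrable on every `[p, q]` with `0 ≤ p ≤ q` (it is measurable and bounded there).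
[folklore] -/
private theorem intervalIntegrable_sq_mul_window {a c δ p q : ℝ} (ha : 0 ≤ a) (hc : 0 ≤ c)
    (hp : 0 ≤ p) (hpq : p ≤ q) :
    IntervalIntegrable (fun u => (ψ (u * a * c) - ψ (u * a) - δ * (u * a)) ^ 2) volume p q := by
  have hmeas : Measurable (fun u => (ψ (u * a * c) - ψ (u * a) - δ * (u * a)) ^ 2) := by
    have h1 : Measurable fun u : ℝ => ψ (u * a * c) :=
      measurable_psi.comp ((measurable_id.mul_const a).mul_const c)
    have h2 : Measurable fun u : ℝ => ψ (u * a) := measurable_psi.comp (measurable_id.mul_const a)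
    exact ((h1.sub h2).sub ((measurable_id.mul_const a).const_mul δ)).pow_const 2
  refine intervalIntegrable_of_abs_le
    (M := (ψ (q * a * c) + ψ (q * a) + |δ| * (q * a)) ^ 2) hmeas fun u hu => ?_
  rw [Set.uIoc_of_le hpq, Set.mem_Ioc] at hu
  have hu0 : 0 ≤ u := hp.trans hu.1.le
  have hua : u * a ≤ q * a := mul_le_mul_of_nonneg_right hu.2 ha
  have huac : u * a * c ≤ q * a * c := mul_le_mul_of_nonneg_right hua hc
  have hb : |ψ (u * a * c) - ψ (u * a) - δ * (u * a)| ≤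
      ψ (q * a * c) + ψ (q * a) + |δ| * (q * a) := by
    have e1 := Chebyshev.psi_nonneg (u * a * c)
    have e2 := Chebyshev.psi_nonneg (u * a)
    have e3 := Chebyshev.psi_mono huac
    have e4 := Chebyshev.psi_mono hua
    have e5 : |δ * (u * a)| ≤ |δ| * (q * a) := by
      rw [abs_mul, abs_of_nonneg (by positivity : 0 ≤ u * a)]
      exact mul_le_mul_of_nonneg_left hua (abs_nonneg δ)
    calc |ψ (u * a * c) - ψ (u * a) - δ * (u * a)|
        ≤ |ψ (u * a * c) - ψ (u * a)| + |δ * (u * a)| := abs_sub _ _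
      _ ≤ |ψ (u * a * c)| + |ψ (u * a)| + |δ * (u * a)| := by
          gcongr; exact abs_sub _ _
      _ ≤ ψ (q * a * c) + ψ (q * a) + |δ| * (q * a) := by
          rw [abs_of_nonneg e1, abs_of_nonneg e2]; gcongr
  rw [abs_pow]
  exact pow_le_pow_left₀ (abs_nonneg _) hb 2

/-- The squared window function `v ↦ (ψ(v(1+δ)) − ψ(v) − δ v)²` is interval integrable on every
`[p, q]` with `0 ≤ p ≤ q` (`δ ≥ -1`). [folklore] -/
private theorem intervalIntegrable_sq_window {δ p q : ℝ} (hδ : 0 ≤ 1 + δ) (hp : 0 ≤ p) (hpq : p ≤ q) :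
    IntervalIntegrable (fun v => (ψ (v * (1 + δ)) - ψ v - δ * v) ^ 2) volume p q := by
  have h := intervalIntegrable_sq_mul_window (a := 1) (c := 1 + δ) (δ := δ) zero_le_one hδ hp hpq
  simp only [mul_one] at h
  exact h

/-! ### §3. Chebyshev's inequality over the exceptional integers -/

/-- **Per-integer step.** If `n ∈ [X, 2X]` is exceptional at level `E` for the window of length
`y ≤ X`, i.e. `|ψ(n+y) − ψ(n) − y| > E ≥ 2 log(3X+1)`, then on `(n, n+1)` the window function stays
`≥ E/2` in absolute value (only the prime power `⌊n+y⌋+1` can enter), so integrating the squared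
splitting bound over `(n, n+1)` gives
`E²/4 − 2δ²(3X+1)² ≤ 2K Σ_{j<K} ∫_n^{n+1} (ψ(u(1+δ)ʲ(1+δ)) − ψ(u(1+δ)ʲ) − δu(1+δ)ʲ)² du`.
[cite: GuthMaynard2026, §13.2 (proof of Corollary 1.4)] -/
theorem threshold_sq_le_sum_integral {X y δ E : ℝ} {K n : ℕ} (hX : 1 ≤ X) (hδ : 0 < δ)
    (hy : 0 < y) (hyX : y ≤ X) (hnX : X ≤ n) (hn2X : (n : ℝ) ≤ 2 * X)
    (hK : 1 + y / X < (1 + δ) ^ K) (hE : 2 * Real.log (3 * X + 1) ≤ E)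
    (hexc : E < |ψ (n + y) - ψ n - y|) :
    E ^ 2 / 4 - 2 * δ ^ 2 * (3 * X + 1) ^ 2 ≤
      2 * K * ∑ j ∈ Finset.range K, ∫ u in (n : ℝ)..n + 1,
        (ψ (u * (1 + δ) ^ j * (1 + δ)) - ψ (u * (1 + δ) ^ j) - δ * (u * (1 + δ) ^ j)) ^ 2 := by
  have hX0 : 0 < X := by linarith
  have hlog0 : 0 ≤ Real.log (3 * X + 1) := Real.log_nonneg (by linarith)
  have hE0 : 0 ≤ E := by linarith
  -- pointwise bound on `(n, n+1)`
  have hpt : ∀ u ∈ Set.Ioo (n : ℝ) (n + 1), E ^ 2 / 4 - 2 * δ ^ 2 * (3 * X + 1) ^ 2 ≤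
      2 * K * ∑ j ∈ Finset.range K,
        (ψ (u * (1 + δ) ^ j * (1 + δ)) - ψ (u * (1 + δ) ^ j) - δ * (u * (1 + δ) ^ j)) ^ 2 := by
    intro u hu
    have hu0 : 0 < u := by linarith [hu.1]
    have hfl : ⌊u⌋₊ = n := (Nat.floor_eq_iff hu0.le).2 ⟨hu.1.le, hu.2⟩
    have hψu : ψ u = ψ n := by rw [Chebyshev.psi_eq_psi_coe_floor u, hfl]
    have hlo : ψ (n + y) ≤ ψ (u + y) := Chebyshev.psi_mono (by linarith [hu.1])
    have hhi : ψ (u + y) ≤ ψ ((n + y) + 1) := Chebyshev.psi_mono (by linarith [hu.2])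
    have hstep : ψ ((n + y) + 1) - ψ (n + y) ≤ Real.log (3 * X + 1) := by
      rw [Halasz.psi_sub_psi_eq (by linarith : (n : ℝ) + y ≤ n + y + 1),
        Nat.floor_add_one (by positivity : (0 : ℝ) ≤ n + y), Nat.Ioc_succ_singleton,
        Finset.sum_singleton]
      have h1 : (ArithmeticFunction.vonMangoldt (⌊(n : ℝ) + y⌋₊ + 1) : ℝ) ≤
          Real.log ((⌊(n : ℝ) + y⌋₊ + 1 : ℕ) : ℝ) :=
        ArithmeticFunction.vonMangoldt_le_log
      have h2 : Real.log ((⌊(n : ℝ) + y⌋₊ + 1 : ℕ) : ℝ) ≤ Real.log (3 * X + 1) := by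
        apply Real.log_le_log (by positivity)
        push_cast
        have := Nat.floor_le (by positivity : (0 : ℝ) ≤ n + y)
        linarith
      exact h1.trans h2
    have hFu : E / 2 ≤ |ψ (u + y) - ψ u - y| := by
      have hdiff : |(ψ (u + y) - ψ u - y) - (ψ (n + y) - ψ n - y)| ≤ E / 2 := by
        rw [hψu]
        have : (ψ (u + y) - ψ (n : ℝ) - y) - (ψ ((n : ℝ) + y) - ψ n - y) =
            ψ (u + y) - ψ (n + y) := by ring
        rw [this, abs_of_nonneg (by linarith)]
        linarith
      have := abs_sub_abs_le_abs_sub (ψ (n + y) - ψ n - y) (ψ (u + y) - ψ u - y)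
      rw [abs_sub_comm (ψ (n + y) - ψ n - y) (ψ (u + y) - ψ u - y)] at this
      linarith
    have hKu : u + y < u * (1 + δ) ^ K := by
      have hyu : y / u ≤ y / X :=
        div_le_div_of_nonneg_left hy.le hX0 (by linarith [hu.1])
      have : u + y = u * (1 + y / u) := by field_simp
      rw [this]
      exact mul_lt_mul_of_pos_left (by linarith) hu0
    have hsq := sq_window_le_sum_mul_windows hu0 hy hδ hKu
    have hE2 : (E / 2) ^ 2 ≤ (ψ (u + y) - ψ u - y) ^ 2 := by
      have := pow_le_pow_left₀ (by linarith : 0 ≤ E / 2) hFu 2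
      rwa [sq_abs] at this
    have hR : (δ * (u + y)) ^ 2 ≤ δ ^ 2 * (3 * X + 1) ^ 2 := by
      have h1 : u + y ≤ 3 * X + 1 := by linarith [hu.2]
      have h0 : 0 ≤ u + y := by linarith
      rw [mul_pow]
      exact mul_le_mul_of_nonneg_left (pow_le_pow_left₀ h0 h1 2) (sq_nonneg δ)
    nlinarith
  -- integrate over `(n, n+1)`
  have hint : ∀ j ∈ Finset.range K, IntervalIntegrable
      (fun u => (ψ (u * (1 + δ) ^ j * (1 + δ)) - ψ (u * (1 + δ) ^ j) - δ * (u * (1 + δ) ^ j)) ^ 2)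
      volume (n : ℝ) (n + 1) := fun j _ =>
    intervalIntegrable_sq_mul_window (pow_nonneg (by linarith) j) (by linarith) (by positivity)
      (by linarith)
  have hsumint : IntervalIntegrable (fun u => 2 * (K : ℝ) * ∑ j ∈ Finset.range K,
      (ψ (u * (1 + δ) ^ j * (1 + δ)) - ψ (u * (1 + δ) ^ j) - δ * (u * (1 + δ) ^ j)) ^ 2)
      volume (n : ℝ) (n + 1) := by
    have h := IntervalIntegrable.sum (Finset.range K) hint
    rw [Finset.sum_fn] at h
    exact h.const_mul _
  have hmono := intervalIntegral.integral_mono_on_of_le_Ioo (μ := volume)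
    (by linarith : (n : ℝ) ≤ n + 1) intervalIntegrable_const hsumint hpt
  rw [intervalIntegral.integral_const, intervalIntegral.integral_const_mul,
    intervalIntegral.integral_finsetSum hint] at hmono
  simpa using hmono

/-- **Chebyshev count of the exceptional integers** (Guth–Maynard §13.2): for a finite set `S` of
integers in `[X, 2X]`, a window length `0 < y ≤ X`, `δ > 0`, `K` with `(1+δ)^K > 1 + y/X` and a
level `E ≥ 2 log(3X+1)`,
`#{n ∈ S : |ψ(n+y) − ψ(n) − y| > E} · (E²/4 − 2δ²(3X+1)²) ≤ 2K² ∫_X^{(2X+1)(1+δ)^K} (ψ(v(1+δ)) − ψ(v) − δv)² dv`.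
[cite: GuthMaynard2026, §13.2 (proof of Corollary 1.4)] -/
theorem card_exceptional_mul_le {X y δ E : ℝ} {K : ℕ} {S : Finset ℕ} (hX : 1 ≤ X) (hδ : 0 < δ)
    (hy : 0 < y) (hyX : y ≤ X) (hS : ∀ n ∈ S, X ≤ (n : ℝ) ∧ (n : ℝ) ≤ 2 * X)
    (hK : 1 + y / X < (1 + δ) ^ K) (hE : 2 * Real.log (3 * X + 1) ≤ E) :
    ((S.filter (fun n : ℕ => E < |ψ ((n : ℝ) + y) - ψ n - y|)).card : ℝ) *
        (E ^ 2 / 4 - 2 * δ ^ 2 * (3 * X + 1) ^ 2) ≤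
      2 * (K : ℝ) ^ 2 *
        ∫ v in X..(2 * X + 1) * (1 + δ) ^ K, (ψ (v * (1 + δ)) - ψ v - δ * v) ^ 2 := by
  have hX0 : 0 < X := by linarith
  have hc1 : 1 ≤ 1 + δ := by linarith
  set S' := S.filter (fun n : ℕ => E < |ψ ((n : ℝ) + y) - ψ n - y|) with hS'
  set T : ℕ → ℝ → ℝ := fun j u =>
    (ψ (u * (1 + δ) ^ j * (1 + δ)) - ψ (u * (1 + δ) ^ j) - δ * (u * (1 + δ) ^ j)) ^ 2 with hT
  set I : ℝ := ∫ v in X..(2 * X + 1) * (1 + δ) ^ K, (ψ (v * (1 + δ)) - ψ v - δ * v) ^ 2 with hI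
  have hT0 : ∀ j u, 0 ≤ T j u := fun j u => sq_nonneg _
  -- step 1: sum the per-integer bounds
  have h1 : (S'.card : ℝ) * (E ^ 2 / 4 - 2 * δ ^ 2 * (3 * X + 1) ^ 2) ≤
      ∑ n ∈ S', 2 * (K : ℝ) * ∑ j ∈ Finset.range K, ∫ u in (n : ℝ)..n + 1, T j u := by
    rw [← nsmul_eq_mul, ← Finset.sum_const]
    refine Finset.sum_le_sum fun n hn => ?_
    obtain ⟨hnS, hexc⟩ := Finset.mem_filter.1 hn
    exact threshold_sq_le_sum_integral hX hδ hy hyX (hS n hnS).1 (hS n hnS).2 hK hE hexc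
  -- step 2: `Σ_{n ∈ S'} ∫_n^{n+1} T_j ≤ ∫_X^{2X+1} T_j`
  have hTint : ∀ j, ∀ p q : ℝ, 0 ≤ p → p ≤ q → IntervalIntegrable (T j) volume p q :=
    fun j p q hp hpq =>
      intervalIntegrable_sq_mul_window (pow_nonneg (by linarith) j) (by linarith) hp hpq
  have h2 : ∀ j, ∑ n ∈ S', ∫ u in (n : ℝ)..n + 1, T j u ≤ ∫ u in X..2 * X + 1, T j u := by
    intro j
    have hdisj : Set.PairwiseDisjoint (↑S' : Set ℕ) (fun n : ℕ => Set.Ioc (n : ℝ) (n + 1)) := by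
      intro n _ m _ hnm
      rw [Function.onFun, Set.Ioc_disjoint_Ioc]
      rcases lt_or_gt_of_ne hnm with h | h
      · have : (n : ℝ) + 1 ≤ m := by exact_mod_cast h
        rw [min_eq_left (by linarith), max_eq_right (by linarith : (n:ℝ) ≤ m)]
        exact this
      · have : (m : ℝ) + 1 ≤ n := by exact_mod_cast h
        rw [min_eq_right (by linarith), max_eq_left (by linarith : (m:ℝ) ≤ n)]
        exact this
    have hU : (⋃ n ∈ S', Set.Ioc (n : ℝ) (n + 1)) ⊆ Set.Ioc X (2 * X + 1) := by
      refine Set.iUnion₂_subset fun n hn => ?_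
      have hn' := hS n (Finset.mem_filter.1 hn).1
      exact Set.Ioc_subset_Ioc hn'.1 (by linarith [hn'.2])
    have hIon : IntegrableOn (T j) (Set.Ioc X (2 * X + 1)) volume :=
      (hTint j X (2 * X + 1) hX0.le (by linarith)).1
    calc ∑ n ∈ S', ∫ u in (n : ℝ)..n + 1, T j u
        = ∑ n ∈ S', ∫ u in Set.Ioc (n : ℝ) (n + 1), T j u := by
          refine Finset.sum_congr rfl fun n _ => ?_
          rw [intervalIntegral.integral_of_le (by linarith)]
      _ = ∫ u in ⋃ n ∈ S', Set.Ioc (n : ℝ) (n + 1), T j u := by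
          rw [MeasureTheory.integral_biUnion_finset S' (fun n _ => measurableSet_Ioc) hdisj
            (fun n hn => hIon.mono_set (by
              have hn' := hS n (Finset.mem_filter.1 hn).1
              exact Set.Ioc_subset_Ioc hn'.1 (by linarith [hn'.2])))]
      _ ≤ ∫ u in Set.Ioc X (2 * X + 1), T j u :=
          MeasureTheory.setIntegral_mono_set hIon
            (Filter.Eventually.of_forall fun u => hT0 j u) hU.eventuallyLE
      _ = ∫ u in X..2 * X + 1, T j u := by
          rw [intervalIntegral.integral_of_le (by linarith)]
  -- step 3: substitution `u ↦ u (1+δ)^j` and enlarging the interval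
  have h3 : ∀ j ∈ Finset.range K, ∫ u in X..2 * X + 1, T j u ≤ I := by
    intro j hj
    have hjK : j ≤ K := (Finset.mem_range.1 hj).le
    have hcj : (1 : ℝ) ≤ (1 + δ) ^ j := one_le_pow₀ hc1
    have hcj0 : (0 : ℝ) < (1 + δ) ^ j := by positivity
    have hsub := intervalIntegral.integral_comp_mul_right
      (fun v => (ψ (v * (1 + δ)) - ψ v - δ * v) ^ 2) (a := X) (b := 2 * X + 1) hcj0.ne'
    have hTj : (∫ u in X..2 * X + 1, T j u) =
        ∫ u in X..2 * X + 1, (fun v => (ψ (v * (1 + δ)) - ψ v - δ * v) ^ 2) (u * (1 + δ) ^ j) := by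
      simp only [hT]
    rw [hTj, hsub, smul_eq_mul]
    have hJ0 : 0 ≤ ∫ v in X * (1 + δ) ^ j..(2 * X + 1) * (1 + δ) ^ j,
        (ψ (v * (1 + δ)) - ψ v - δ * v) ^ 2 :=
      intervalIntegral.integral_nonneg (by nlinarith) fun v _ => sq_nonneg _
    have hJle : ∫ v in X * (1 + δ) ^ j..(2 * X + 1) * (1 + δ) ^ j,
        (ψ (v * (1 + δ)) - ψ v - δ * v) ^ 2 ≤ I := by
      refine intervalIntegral.integral_mono_interval (le_mul_of_one_le_right hX0.le hcj)
        (by nlinarith) (mul_le_mul_of_nonneg_left (pow_le_pow_right₀ hc1 hjK) (by linarith))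
        (Filter.Eventually.of_forall fun v => sq_nonneg _) ?_
      exact intervalIntegrable_sq_window (by linarith) hX0.le
        ((by linarith : X ≤ 2 * X + 1).trans
          (le_mul_of_one_le_right (by linarith) (one_le_pow₀ hc1)))
    calc ((1 + δ) ^ j)⁻¹ * ∫ v in X * (1 + δ) ^ j..(2 * X + 1) * (1 + δ) ^ j,
          (ψ (v * (1 + δ)) - ψ v - δ * v) ^ 2
        ≤ 1 * ∫ v in X * (1 + δ) ^ j..(2 * X + 1) * (1 + δ) ^ j,
          (ψ (v * (1 + δ)) - ψ v - δ * v) ^ 2 :=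
          mul_le_mul_of_nonneg_right (inv_le_one_of_one_le₀ hcj) hJ0
      _ ≤ I := by rw [one_mul]; exact hJle
  -- combine
  calc (S'.card : ℝ) * (E ^ 2 / 4 - 2 * δ ^ 2 * (3 * X + 1) ^ 2)
      ≤ ∑ n ∈ S', 2 * (K : ℝ) * ∑ j ∈ Finset.range K, ∫ u in (n : ℝ)..n + 1, T j u := h1
    _ = 2 * (K : ℝ) * ∑ j ∈ Finset.range K, ∑ n ∈ S', ∫ u in (n : ℝ)..n + 1, T j u := by
        rw [← Finset.mul_sum, Finset.sum_comm]
    _ ≤ 2 * (K : ℝ) * ∑ j ∈ Finset.range K, I := by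
        gcongr with j hj
        exact (h2 j).trans (h3 j hj)
    _ = 2 * (K : ℝ) ^ 2 * I := by
        rw [Finset.sum_const, Finset.card_range, nsmul_eq_mul]; ring


/-! ### §4. From `ψ` to `π` in a short window (GM §13.2: "by partial summation") -/

/-- Pointwise transfer in the form used for the non-exceptional integers: for a natural `n ≥ 3`,
`y ≥ 0` and `|ψ(n+y) − ψ(n) − y| ≤ E`,
`|π(n+y) − π(n) − y/log n| ≤ E + (y/(2√n) + 1) log²(n+y) + y²/n`. This is
`PrimeWindow.abs_primeCounting_window_sub_le_of_abs_psi_le_sharp` (each prime `p ∈ (n, n+y]` has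
`log n ≤ log p ≤ log n + y/n`; the proper prime powers in `(n, n+y]` weigh `≤ (y/(2√n)+1) log²(n+y)`)
with `log n ≥ 1` used to drop the denominators.
[cite: GuthMaynard2026, §13.2 (proof of Cor. 1.3 and 1.4, "By partial summation")] -/
theorem abs_pi_window_le_of_abs_psi_le {n : ℕ} {y E : ℝ} (hn : (3 : ℝ) ≤ n) (hy : 0 ≤ y)
    (hE : |ψ ((n : ℝ) + y) - ψ n - y| ≤ E) :
    |(π ⌊(n : ℝ) + y⌋₊ : ℝ) - π n - y / Real.log n| ≤
      E + (y / (2 * Real.sqrt n) + 1) * Real.log (n + y) ^ 2 + y ^ 2 / n := by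
  have hn0 : (0 : ℝ) < n := by linarith
  have hlogn1 : 1 ≤ Real.log n := by
    rw [← Real.log_exp 1]
    refine Real.log_le_log (Real.exp_pos 1) (le_trans ?_ hn)
    have := Real.exp_one_lt_d9; linarith
  have hE0 : 0 ≤ E := (abs_nonneg _).trans hE
  have h := PrimeWindow.abs_primeCounting_window_sub_le_of_abs_psi_le_sharp (x := (n : ℝ))
    (by linarith) hy hE
  rw [Nat.floor_natCast] at h
  have h1 : E / Real.log n ≤ E := div_le_self hE0 hlogn1
  have h2 : (y / (2 * Real.sqrt n) + 1) * Real.log (n + y) ^ 2 / Real.log n ≤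
      (y / (2 * Real.sqrt n) + 1) * Real.log (n + y) ^ 2 :=
    div_le_self (by positivity) hlogn1
  have h3 : y ^ 2 / (n * Real.log n ^ 2) ≤ y ^ 2 / n := by
    refine div_le_div_of_nonneg_left (by positivity) hn0 ?_
    calc (n : ℝ) = n * 1 := (mul_one _).symm
      _ ≤ n * Real.log n ^ 2 := mul_le_mul_of_nonneg_left (one_le_pow₀ hlogn1) hn0.le
  linarith

/-! ### §5. Growth lemmas -/

/-- For every `a > 0`, `c > 0`: `log X ≤ c X^a` for all large `X` (Mathlib's `log = o(x^a)`).
[folklore] -/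
private theorem exists_log_le_mul_rpow {a c : ℝ} (ha : 0 < a) (hc : 0 < c) :
    ∃ T : ℝ, ∀ X : ℝ, T ≤ X → Real.log X ≤ c * X ^ a := by
  have h := (isLittleO_log_rpow_atTop ha).bound hc
  obtain ⟨T, hT⟩ := Filter.eventually_atTop.1 h
  refine ⟨max T 0, fun X hX => ?_⟩
  have hX0 : 0 ≤ X := le_trans (le_max_right _ _) hX
  have := hT X (le_trans (le_max_left _ _) hX)
  rw [Real.norm_eq_abs, Real.norm_eq_abs, abs_of_nonneg (Real.rpow_nonneg hX0 a)] at this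
  exact (le_abs_self _).trans this

/-- The two growth facts used below: for `0 < η ≤ 1` and all large `X`,
`32 exp((log 2X)^{1/4}) ≤ X^η` and `36 log² X ≤ X^η` (the first from
`PrimeWindow.exists_exp_log_rpow_le_rpow`). [folklore] -/
private theorem exists_growth_threshold {η : ℝ} (hη : 0 < η) (hη1 : η ≤ 1) :
    ∃ T : ℝ, ∀ X : ℝ, T ≤ X →
      32 * Real.exp (Real.log (2 * X) ^ (1 / 4 : ℝ)) ≤ X ^ η ∧
        36 * Real.log X ^ 2 ≤ X ^ η := by
  obtain ⟨T₁, hT₁⟩ := PrimeWindow.exists_exp_log_rpow_le_rpow (a := η / 2) (κ := 1 / 4)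
    (by positivity) (by norm_num)
  obtain ⟨T₂, hT₂⟩ := exists_log_le_mul_rpow (a := η / 2) (c := 1 / 6) (by positivity) (by norm_num)
  refine ⟨max (max T₁ T₂) (max 1 ((64 : ℝ) ^ (2 / η))), fun X hX => ?_⟩
  have hX1 : 1 ≤ X := le_trans (le_trans (le_max_left _ _) (le_max_right _ _)) hX
  have hX0 : 0 < X := by linarith
  have hXT₁ : T₁ ≤ 2 * X := by
    have : T₁ ≤ X := le_trans (le_trans (le_max_left _ _) (le_max_left _ _)) hX
    linarith
  have hXT₂ : T₂ ≤ X := le_trans (le_trans (le_max_right _ _) (le_max_left _ _)) hX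
  have hX64 : (64 : ℝ) ^ (2 / η) ≤ X := le_trans (le_trans (le_max_right _ _) (le_max_right _ _)) hX
  have hhalf : (64 : ℝ) ≤ X ^ (η / 2) := by
    have e : ((64 : ℝ) ^ (2 / η)) ^ (η / 2) = 64 := by
      rw [← Real.rpow_mul (by norm_num)]
      have : 2 / η * (η / 2) = 1 := by field_simp
      rw [this, Real.rpow_one]
    rw [← e]
    exact Real.rpow_le_rpow (by positivity) hX64 (by positivity)
  have hsq : X ^ (η / 2) * X ^ (η / 2) = X ^ η := by
    rw [← Real.rpow_add hX0]; ring_nf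
  constructor
  · have h1 := hT₁ (2 * X) hXT₁
    have h2 : (2 * X) ^ (η / 2) ≤ 2 * X ^ (η / 2) := by
      rw [Real.mul_rpow (by norm_num) hX0.le]
      refine mul_le_mul_of_nonneg_right ?_ (Real.rpow_nonneg hX0.le _)
      calc (2 : ℝ) ^ (η / 2) ≤ 2 ^ (1 : ℝ) :=
            Real.rpow_le_rpow_of_exponent_le (by norm_num) (by linarith)
        _ = 2 := Real.rpow_one 2
    have h0 : 0 ≤ X ^ (η / 2) := Real.rpow_nonneg hX0.le _
    nlinarith
  · have h1 := hT₂ X hXT₂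
    have hlog0 : 0 ≤ Real.log X := Real.log_nonneg hX1
    have h0 : 0 ≤ X ^ (η / 2) := Real.rpow_nonneg hX0.le _
    nlinarith

/-- `(log 2X)^{1/4} ≤ (log X)^{1/4} + 1` for `X ≥ 1`. [folklore] -/
private theorem rpow_quarter_log_two_mul_le {X : ℝ} (hX : 1 ≤ X) :
    Real.log (2 * X) ^ (1 / 4 : ℝ) ≤ Real.log X ^ (1 / 4 : ℝ) + 1 := by
  have hX0 : 0 < X := by linarith
  rw [Real.log_mul (by norm_num) hX0.ne']
  have hlog2 : 0 ≤ Real.log 2 := Real.log_nonneg (by norm_num)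
  have hlogX : 0 ≤ Real.log X := Real.log_nonneg hX
  have h1 := Real.rpow_add_le_add_rpow hlog2 hlogX (by norm_num : (0 : ℝ) ≤ 1 / 4)
    (by norm_num : (1 / 4 : ℝ) ≤ 1)
  have h2 : Real.log 2 ^ (1 / 4 : ℝ) ≤ 1 := by
    refine Real.rpow_le_one hlog2 ?_ (by norm_num)
    have := Real.log_two_lt_d9; linarith
  linarith


/-- `3X + 1 ≤ X³` for `X ≥ 3`. [folklore] -/
private theorem three_mul_add_one_le_cube {X : ℝ} (hX : 3 ≤ X) : 3 * X + 1 ≤ X ^ 3 := by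
  have h1 : 9 * X ≤ X ^ 3 := by
    have : 9 ≤ X * X := by nlinarith
    nlinarith
  linarith

/-! ### §6. Corollary 1.4 from the mean-square estimate -/

/-- Bookkeeping for the non-exceptional integers (GM §13.2): with `η ≤ 1/100`,
`32 exp((log 2X)^{1/4}) ≤ X^η`, `36 log² X ≤ X^η`, `X^{2/15} ≤ y ≤ X^{0.99}` and `n ∈ [X, 2X]`,
`y exp(−(log 2X)^{1/4}) + (y/(2√n) + 1) log²(n+y) + y²/n ≤ 3 y exp(−(log n)^{1/4})`.
[cite: GuthMaynard2026, §13.2 (proof of Cor. 1.4, partial-summation error bookkeeping)] -/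
theorem window_bookkeeping {X y η : ℝ} {n : ℕ} (hX3 : 3 ≤ X) (hη100 : η ≤ 1 / 100)
    (hi : 32 * Real.exp (Real.log (2 * X) ^ (1 / 4 : ℝ)) ≤ X ^ η)
    (hii : 36 * Real.log X ^ 2 ≤ X ^ η)
    (hy215 : X ^ (2 / 15 : ℝ) ≤ y) (hy2 : y ≤ X ^ (99 / 100 : ℝ))
    (hnX : X ≤ n) (hn2X : (n : ℝ) ≤ 2 * X) :
    y * Real.exp (-Real.log (2 * X) ^ (1 / 4 : ℝ)) +
        (y / (2 * Real.sqrt n) + 1) * Real.log (n + y) ^ 2 + y ^ 2 / n ≤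
      3 * y * Real.exp (-(Real.log n) ^ (1 / 4 : ℝ)) := by
  have hX1 : 1 ≤ X := by linarith
  have hX0 : 0 < X := by linarith
  have hn0 : (0 : ℝ) < n := by linarith
  have hy0 : 0 < y := lt_of_lt_of_le (Real.rpow_pos_of_pos hX0 _) hy215
  have hyX : y ≤ X := hy2.trans (by
    calc X ^ (99 / 100 : ℝ) ≤ X ^ (1 : ℝ) := Real.rpow_le_rpow_of_exponent_le hX1 (by norm_num)
      _ = X := Real.rpow_one X)
  have hXη0 : 0 < X ^ η := Real.rpow_pos_of_pos hX0 _
  set M : ℝ := Real.log (2 * X) ^ (1 / 4 : ℝ) with hM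
  set en : ℝ := Real.exp (-(Real.log n) ^ (1 / 4 : ℝ)) with hen
  have hexpM : 32 / X ^ η ≤ Real.exp (-M) := by
    rw [Real.exp_neg, ← one_div, div_le_div_iff₀ hXη0 (Real.exp_pos M), one_mul]
    exact hi
  have hen_ge : Real.exp (-M) ≤ en := by
    rw [hen, Real.exp_le_exp, neg_le_neg_iff, hM]
    exact Real.rpow_le_rpow (Real.log_nonneg (by linarith))
      (Real.log_le_log hn0 hn2X) (by norm_num)
  have hen32 : 32 / X ^ η ≤ en := hexpM.trans hen_ge
  -- (a)
  have ha : y * Real.exp (-M) ≤ y * en := mul_le_mul_of_nonneg_left hen_ge hy0.le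
  -- (c)
  have hlogX1 : 1 ≤ Real.log X := by
    rw [← Real.log_exp 1]
    refine Real.log_le_log (Real.exp_pos 1) (le_trans ?_ hX3)
    have := Real.exp_one_lt_d9; linarith
  have hlog3X : Real.log ((n : ℝ) + y) ≤ 2 * Real.log X := by
    have e : Real.log (X ^ 2) = 2 * Real.log X := by
      rw [Real.log_pow]; norm_num
    rw [← e]
    have hsq3 : (n : ℝ) + y ≤ X ^ 2 := by
      have : 3 * X ≤ X ^ 2 := by rw [pow_two]; exact mul_le_mul_of_nonneg_right hX3 hX0.le
      linarith
    exact Real.log_le_log (by linarith) hsq3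
  have hlogsq' : Real.log ((n : ℝ) + y) ^ 2 ≤ X ^ η / 9 := by
    have h0 : 0 ≤ Real.log ((n : ℝ) + y) := Real.log_nonneg (by linarith)
    calc Real.log ((n : ℝ) + y) ^ 2 ≤ (2 * Real.log X) ^ 2 := pow_le_pow_left₀ h0 hlog3X 2
      _ = 4 * Real.log X ^ 2 := by ring
      _ ≤ X ^ η / 9 := by linarith
  have hsqrt : y / (2 * Real.sqrt n) ≤ y / (2 * Real.sqrt X) :=
    div_le_div_of_nonneg_left hy0.le (by positivity)
      (mul_le_mul_of_nonneg_left (Real.sqrt_le_sqrt hnX) (by norm_num))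
  have hX2η : X ^ η * X ^ η = X ^ (2 * η) := by rw [← Real.rpow_add hX0]; ring_nf
  have hc1 : y / (2 * Real.sqrt X) * (X ^ η / 9) ≤ y / 2 * (32 / X ^ η) := by
    have hsx : 0 < Real.sqrt X := Real.sqrt_pos.2 hX0
    have hkey : X ^ η * X ^ η ≤ 9 * 32 * Real.sqrt X := by
      rw [hX2η, Real.sqrt_eq_rpow]
      calc X ^ (2 * η) ≤ X ^ (1 / 2 : ℝ) :=
            Real.rpow_le_rpow_of_exponent_le hX1 (by linarith)
        _ ≤ 9 * 32 * X ^ (1 / 2 : ℝ) := by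
            linarith [Real.rpow_nonneg hX0.le (1 / 2 : ℝ)]
    rw [div_mul_div_comm, div_mul_div_comm, div_le_div_iff₀ (by positivity) (by positivity)]
    calc y * X ^ η * (2 * X ^ η) = 2 * y * (X ^ η * X ^ η) := by ring
      _ ≤ 2 * y * (9 * 32 * Real.sqrt X) := mul_le_mul_of_nonneg_left hkey (by positivity)
      _ = y * 32 * (2 * Real.sqrt X * 9) := by ring
  have hc2 : X ^ η / 9 ≤ y / 2 * (32 / X ^ η) := by
    have hkey : X ^ η * X ^ η ≤ y := by
      rw [hX2η]
      exact (Real.rpow_le_rpow_of_exponent_le hX1 (by linarith)).trans hy215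
    rw [show y / 2 * (32 / X ^ η) = 16 * y / X ^ η by ring, le_div_iff₀ hXη0]
    calc X ^ η / 9 * X ^ η = (X ^ η * X ^ η) / 9 := by ring
      _ ≤ y / 9 := by gcongr
      _ ≤ 16 * y := by linarith
  have hc : (y / (2 * Real.sqrt n) + 1) * Real.log (n + y) ^ 2 ≤ y * en := by
    calc (y / (2 * Real.sqrt n) + 1) * Real.log ((n : ℝ) + y) ^ 2
        ≤ (y / (2 * Real.sqrt X) + 1) * (X ^ η / 9) := by gcongr
      _ = y / (2 * Real.sqrt X) * (X ^ η / 9) + X ^ η / 9 := by ring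
      _ ≤ y / 2 * (32 / X ^ η) + y / 2 * (32 / X ^ η) := add_le_add hc1 hc2
      _ = y * (32 / X ^ η) := by ring
      _ ≤ y * en := mul_le_mul_of_nonneg_left hen32 hy0.le
  -- (d)
  have hd : y ^ 2 / n ≤ y * en := by
    have hyoverX : y / X ≤ X ^ (-(1 / 100 : ℝ)) := by
      rw [div_le_iff₀ hX0]
      calc y ≤ X ^ (99 / 100 : ℝ) := hy2
        _ = X ^ (-(1 / 100 : ℝ)) * X := by
            rw [← Real.rpow_add_one hX0.ne']; norm_num
    have h1 : y ^ 2 / n ≤ y ^ 2 / X := div_le_div_of_nonneg_left (by positivity) hX0 hnX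
    have h2 : y ^ 2 / X ≤ y * X ^ (-(1 / 100 : ℝ)) := by
      rw [pow_two, mul_div_assoc]
      exact mul_le_mul_of_nonneg_left hyoverX hy0.le
    have h3 : X ^ (-(1 / 100 : ℝ)) ≤ 32 / X ^ η := by
      calc X ^ (-(1 / 100 : ℝ)) ≤ X ^ (-η) :=
            Real.rpow_le_rpow_of_exponent_le hX1 (by linarith)
        _ = 1 / X ^ η := by rw [Real.rpow_neg hX0.le, one_div]
        _ ≤ 32 / X ^ η := div_le_div_of_nonneg_right (by norm_num) hXη0.le
    calc y ^ 2 / n ≤ y * X ^ (-(1 / 100 : ℝ)) := h1.trans h2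
      _ ≤ y * (32 / X ^ η) := mul_le_mul_of_nonneg_left h3 hy0.le
      _ ≤ y * en := mul_le_mul_of_nonneg_left hen32 hy0.le
  have : y * Real.exp (-M) + (y / (2 * Real.sqrt n) + 1) * Real.log (n + y) ^ 2 + y ^ 2 / n ≤
      y * en + y * en + y * en := add_le_add (add_le_add ha hc) hd
  linarith

/-- Final bookkeeping of the Chebyshev count (GM §13.2): pure real-number algebra turning
`N (E₀²/4 − 2δ²(3X+1)²) ≤ 2K² I`, `I ≤ C δ²X³e^{−3L}`, `KδX ≤ 2y`, `16δX ≤ E₀ = y e^{−M}`,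
`M ≤ L + 1` into `N ≤ 64 e² C X e^{−L}`.
[cite: GuthMaynard2026, §13.2 (proof of Cor. 1.4, "If the corollary was false, the left hand side would be significantly larger than y²X exp(−3(log X)^{1/4})")] -/
theorem count_bookkeeping {N E₀ I δ X y C L M : ℝ} {K : ℕ} (hN0 : 0 ≤ N) (hy0 : 0 < y)
    (hX1 : 1 ≤ X) (hδ0 : 0 < δ) (hC : 0 ≤ C)
    (hcore : N * (E₀ ^ 2 / 4 - 2 * δ ^ 2 * (3 * X + 1) ^ 2) ≤ 2 * (K : ℝ) ^ 2 * I)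
    (hI : I ≤ C * δ ^ 2 * X ^ 3 * Real.exp (-3 * L)) (hK2y : (K : ℝ) * (δ * X) ≤ 2 * y)
    (h16 : 16 * (δ * X) ≤ E₀) (hE₀ : E₀ = y * Real.exp (-M)) (hML : M ≤ L + 1) :
    N ≤ 64 * Real.exp 2 * C * X * Real.exp (-L) := by
  have hX0 : 0 < X := by linarith
  have hR : 16 * δ ^ 2 * (3 * X + 1) ^ 2 ≤ E₀ ^ 2 := by
    have h1 : 4 * δ * (3 * X + 1) ≤ E₀ := by
      have : δ ≤ δ * X := le_mul_of_one_le_right hδ0.le hX1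
      linarith
    have h0 : 0 ≤ 4 * δ * (3 * X + 1) := by positivity
    calc 16 * δ ^ 2 * (3 * X + 1) ^ 2 = (4 * δ * (3 * X + 1)) ^ 2 := by ring
      _ ≤ E₀ ^ 2 := pow_le_pow_left₀ h0 h1 2
  have h2 : N * (E₀ ^ 2 / 8) ≤ 2 * (K : ℝ) ^ 2 * I :=
    (mul_le_mul_of_nonneg_left (by linarith) hN0).trans hcore
  have h3 : ((K : ℝ) * (δ * X)) ^ 2 ≤ (2 * y) ^ 2 := pow_le_pow_left₀ (by positivity) hK2y 2
  have hmain : N * E₀ ^ 2 ≤ 64 * C * X * Real.exp (-3 * L) * y ^ 2 := by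
    calc N * E₀ ^ 2 = 8 * (N * (E₀ ^ 2 / 8)) := by ring
      _ ≤ 8 * (2 * (K : ℝ) ^ 2 * I) := mul_le_mul_of_nonneg_left h2 (by norm_num)
      _ ≤ 8 * (2 * (K : ℝ) ^ 2 * (C * δ ^ 2 * X ^ 3 * Real.exp (-3 * L))) :=
          mul_le_mul_of_nonneg_left (mul_le_mul_of_nonneg_left hI (by positivity)) (by norm_num)
      _ = 16 * C * X * Real.exp (-3 * L) * ((K : ℝ) * (δ * X)) ^ 2 := by ring
      _ ≤ 16 * C * X * Real.exp (-3 * L) * (2 * y) ^ 2 :=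
          mul_le_mul_of_nonneg_left h3 (by positivity)
      _ = 64 * C * X * Real.exp (-3 * L) * y ^ 2 := by ring
  have hpos : 0 < y ^ 2 * Real.exp (-2 * L) := by positivity
  have hE₀sq : E₀ ^ 2 = y ^ 2 * Real.exp (-2 * M) := by
    rw [hE₀, mul_pow, ← Real.exp_nat_mul]; ring_nf
  have hexp1 : Real.exp (-2 * L) ≤ Real.exp 2 * Real.exp (-2 * M) := by
    rw [← Real.exp_add, Real.exp_le_exp]; linarith
  have hexp3 : Real.exp (-3 * L) = Real.exp (-L) * Real.exp (-2 * L) := by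
    rw [← Real.exp_add]; ring_nf
  refine le_of_mul_le_mul_right ?_ hpos
  calc N * (y ^ 2 * Real.exp (-2 * L)) ≤ N * (y ^ 2 * (Real.exp 2 * Real.exp (-2 * M))) := by
        gcongr
    _ = Real.exp 2 * (N * E₀ ^ 2) := by rw [hE₀sq]; ring
    _ ≤ Real.exp 2 * (64 * C * X * Real.exp (-3 * L) * y ^ 2) :=
        mul_le_mul_of_nonneg_left hmain (Real.exp_pos 2).le
    _ = 64 * Real.exp 2 * C * X * Real.exp (-L) * (y ^ 2 * Real.exp (-2 * L)) := by
        rw [hexp3]; ring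

set_option maxHeartbeats 400000 in
-- one long bookkeeping proof (parameters `δ, K, E₀` and the growth thresholds); ≈ 230k heartbeats
/-- **Guth–Maynard Corollary 1.4 from the `ψ` mean square** (§13.2, p0029:L55–L62): the
mean-square bound `GuthMaynard2026_psiMeanSquareShort` (eq. (AlmostAllTarget), used with the
printed exponent `A = 3` and `δ = X^{-13/15+ε/2}`) implies Corollary 1.4 as printed: for
`y ∈ [X^{2/15+ε}, X^{0.99}]`, all but `O_ε(X exp(−(log X)^{1/4}))` integers `x ∈ [X, 2X]` satisfy
`|π(x+y) − π(x) − y/log x| ≤ 3 y exp(−(log x)^{1/4})`. Road: split `[x, x+y]` into `K ≍ y/(δX)`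
multiplicative `δ`-windows (minimal `K` with `(1+δ)^K > 1 + y/X`), Cauchy–Schwarz, Chebyshev over
the integers with `|ψ(x+y) − ψ(x) − y| > y exp(−(log 2X)^{1/4})` (`card_exceptional_mul_le`), and the
pointwise transfer `ψ → π` (`abs_pi_window_le_of_abs_psi_le`, `window_bookkeeping`) on the
remaining integers. NOT RH-BEARING: a theorem about primes in almost all short intervals.
[cite: GuthMaynard2026, Corollary 1.4 and §13.2] -/
theorem corollary_1_4_of_psiMeanSquareShort (h : GuthMaynard2026_psiMeanSquareShort) :
    GuthMaynard2026_corollary_1_4 := by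
  classical
  intro ε hε
  -- parameters
  set η : ℝ := min (ε / 2) (1 / 100) / 2 with hη
  have hηmin : 0 < min (ε / 2) (1 / 100) := lt_min (by positivity) (by norm_num)
  have hη0 : 0 < η := by rw [hη]; positivity
  have hηε : η ≤ ε / 2 := by
    have := min_le_left (ε / 2) (1 / 100); rw [hη]; linarith
  have hη100 : η ≤ 1 / 100 := by
    have := min_le_right (ε / 2) (1 / 100); rw [hη]; linarith
  obtain ⟨C₈, X₈, h8⟩ := h (ε / 2) (by positivity) 3
  obtain ⟨T, hT⟩ := exists_growth_threshold hη0 (by linarith)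
  set C₉ : ℝ := max C₈ 1 with hC₉
  have hC₉1 : 1 ≤ C₉ := le_max_right _ _
  have hC₈9 : C₈ ≤ C₉ := le_max_left _ _
  refine ⟨3, 64 * Real.exp 2 * C₉, max (max X₈ T) 3, fun X hX y hy1 hy2 => ?_⟩
  -- basic facts about `X`
  have hX3 : 3 ≤ X := le_trans (le_max_right _ _) hX
  have hX1 : 1 ≤ X := by linarith
  have hX0 : 0 < X := by linarith
  have hX8 : X₈ ≤ X := le_trans (le_trans (le_max_left _ _) (le_max_left _ _)) hX
  have hXT : T ≤ X := le_trans (le_trans (le_max_right _ _) (le_max_left _ _)) hX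
  obtain ⟨hi, hii⟩ := hT X hXT
  have hlogX1 : 1 ≤ Real.log X := by
    rw [← Real.log_exp 1]
    refine Real.log_le_log (Real.exp_pos 1) (le_trans ?_ hX3)
    have := Real.exp_one_lt_d9; linarith
  -- non-vacuity forces `2/15 + ε ≤ 99/100`
  have hεle : 2 / 15 + ε ≤ 99 / 100 := by
    by_contra hcon
    push Not at hcon
    have : X ^ (99 / 100 : ℝ) < X ^ (2 / 15 + ε) :=
      Real.rpow_lt_rpow_of_exponent_lt (by linarith) hcon
    linarith
  -- facts about `y`
  have hy0 : 0 < y := lt_of_lt_of_le (Real.rpow_pos_of_pos hX0 _) hy1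
  have hyX : y ≤ X := hy2.trans (by
    calc X ^ (99 / 100 : ℝ) ≤ X ^ (1 : ℝ) := Real.rpow_le_rpow_of_exponent_le hX1 (by norm_num)
      _ = X := Real.rpow_one X)
  have hy215 : X ^ (2 / 15 : ℝ) ≤ y :=
    (Real.rpow_le_rpow_of_exponent_le hX1 (by linarith : (2 / 15 : ℝ) ≤ 2 / 15 + ε)).trans hy1
  have hyoverX : y / X ≤ X ^ (-(1 / 100 : ℝ)) := by
    rw [div_le_iff₀ hX0]
    calc y ≤ X ^ (99 / 100 : ℝ) := hy2
      _ = X ^ (-(1 / 100 : ℝ)) * X := by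
          rw [← Real.rpow_add_one hX0.ne']; norm_num
  -- the growth facts in usable form
  set M : ℝ := Real.log (2 * X) ^ (1 / 4 : ℝ) with hM
  have hML : M ≤ Real.log X ^ (1 / 4 : ℝ) + 1 := rpow_quarter_log_two_mul_le hX1
  have hM0 : 0 ≤ M := Real.rpow_nonneg (Real.log_nonneg (by linarith)) _
  have hXη0 : 0 < X ^ η := Real.rpow_pos_of_pos hX0 _
  have hexpM : 32 / X ^ η ≤ Real.exp (-M) := by
    rw [Real.exp_neg, ← one_div, div_le_div_iff₀ hXη0 (Real.exp_pos M), one_mul]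
    exact hi
  have hXη32 : 32 ≤ X ^ η := by
    have : (1 : ℝ) ≤ Real.exp M := Real.one_le_exp hM0
    linarith
  have hXηsmall : X ^ (-(1 / 100 : ℝ)) ≤ 1 / 32 := by
    rw [Real.rpow_neg hX0.le, show (1 : ℝ) / 32 = (32 : ℝ)⁻¹ by norm_num]
    exact inv_anti₀ (by norm_num)
      (hXη32.trans (Real.rpow_le_rpow_of_exponent_le hX1 hη100))
  -- `E₀` and its lower bound
  set E₀ : ℝ := y * Real.exp (-M) with hE₀
  have hE₀low : 32 * X ^ (2 / 15 + ε - η) ≤ E₀ := by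
    rw [Real.rpow_sub hX0, hE₀]
    calc 32 * (X ^ (2 / 15 + ε) / X ^ η) = X ^ (2 / 15 + ε) * (32 / X ^ η) := by ring
      _ ≤ y * Real.exp (-M) :=
          mul_le_mul hy1 hexpM (by positivity) hy0.le
  have hE₀low' : X ^ η ≤ E₀ := by
    calc X ^ η ≤ X ^ (2 / 15 + ε - η) :=
          Real.rpow_le_rpow_of_exponent_le hX1 (by linarith)
      _ ≤ 32 * X ^ (2 / 15 + ε - η) := by
          linarith [Real.rpow_nonneg hX0.le (2 / 15 + ε - η)]
      _ ≤ E₀ := hE₀low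
  -- `δ`
  set δ : ℝ := X ^ (-(13 / 15 : ℝ) + ε / 2) with hδ
  have hδ0 : 0 < δ := Real.rpow_pos_of_pos hX0 _
  have hδX : δ * X = X ^ (2 / 15 + ε / 2) := by
    rw [hδ, ← Real.rpow_add_one hX0.ne']; congr 1; ring
  have hδXy : δ * X ≤ y := by
    rw [hδX]
    exact (Real.rpow_le_rpow_of_exponent_le hX1 (by linarith)).trans hy1
  have hδ100 : δ ≤ X ^ (-(1 / 100 : ℝ)) :=
    Real.rpow_le_rpow_of_exponent_le hX1 (by linarith)
  have hδsmall : δ ≤ 1 / 32 := hδ100.trans hXηsmall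
  have hyXsmall : y / X ≤ 1 / 32 := hyoverX.trans hXηsmall
  have h16δX : 16 * (δ * X) ≤ E₀ := by
    rw [hδX]
    calc 16 * X ^ (2 / 15 + ε / 2) ≤ 32 * X ^ (2 / 15 + ε - η) := by
          have : X ^ (2 / 15 + ε / 2) ≤ X ^ (2 / 15 + ε - η) :=
            Real.rpow_le_rpow_of_exponent_le hX1 (by linarith)
          linarith [Real.rpow_nonneg hX0.le (2 / 15 + ε / 2)]
      _ ≤ E₀ := hE₀low
  -- `K`: the least number of `δ`-windows covering `[x, x+y]`
  have hex : ∃ K : ℕ, 1 + y / X < (1 + δ) ^ K :=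
    pow_unbounded_of_one_lt (1 + y / X) (by linarith)
  obtain ⟨K, hKspec, hKmin⟩ : ∃ K : ℕ, 1 + y / X < (1 + δ) ^ K ∧
      ∀ m : ℕ, m < K → ¬ (1 + y / X < (1 + δ) ^ m) :=
    ⟨Nat.find hex, Nat.find_spec hex, fun m hm => Nat.find_min hex hm⟩
  have hK0 : K ≠ 0 := by
    intro h0
    rw [h0, pow_zero] at hKspec
    linarith [div_pos hy0 hX0]
  have hKprev : (1 + δ) ^ (K - 1) ≤ 1 + y / X := not_lt.1 (hKmin (K - 1) (by omega))
  have hKpow : (1 + δ) ^ K ≤ (1 + δ) * (1 + y / X) := by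
    have e : (1 + δ) ^ K = (1 + δ) ^ (K - 1) * (1 + δ) := by
      rw [← pow_succ, Nat.sub_add_cancel (Nat.one_le_iff_ne_zero.2 hK0)]
    rw [e, mul_comm]
    exact mul_le_mul_of_nonneg_left hKprev (by linarith)
  have hKle : (K : ℝ) ≤ y / (δ * X) + 1 := by
    have hB : 1 + y / X < (1 + δ) ^ (⌊y / (δ * X)⌋₊ + 1) := by
      have h1 : 1 + ((⌊y / (δ * X)⌋₊ + 1 : ℕ) : ℝ) * δ ≤ (1 + δ) ^ (⌊y / (δ * X)⌋₊ + 1) :=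
        one_add_mul_le_pow (by linarith) _
      have h2 : y / X < ((⌊y / (δ * X)⌋₊ + 1 : ℕ) : ℝ) * δ := by
        have h3 := Nat.lt_floor_add_one (y / (δ * X))
        have h4 : y / X = y / (δ * X) * δ := by field_simp
        rw [h4]; push_cast
        exact mul_lt_mul_of_pos_right h3 hδ0
      linarith
    have hKB : K ≤ ⌊y / (δ * X)⌋₊ + 1 := by
      by_contra hcon
      exact hKmin _ (by omega) hB
    calc (K : ℝ) ≤ ((⌊y / (δ * X)⌋₊ + 1 : ℕ) : ℝ) := by exact_mod_cast hKB
      _ = (⌊y / (δ * X)⌋₊ : ℝ) + 1 := by push_cast; ring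
      _ ≤ y / (δ * X) + 1 := by linarith [Nat.floor_le (show 0 ≤ y / (δ * X) by positivity)]
  have hK2y : (K : ℝ) * (δ * X) ≤ 2 * y := by
    have := mul_le_mul_of_nonneg_right hKle (by positivity : 0 ≤ δ * X)
    rw [add_mul, one_mul, div_mul_cancel₀ _ (ne_of_gt (by positivity))] at this
    linarith
  have hX₁ : (2 * X + 1) * (1 + δ) ^ K ≤ 3 * X := by
    calc (2 * X + 1) * (1 + δ) ^ K ≤ (2 * X + 1) * ((1 + δ) * (1 + y / X)) :=
          mul_le_mul_of_nonneg_left hKpow (by linarith)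
      _ ≤ (2 * X + 1) * ((1 + 1 / 32) * (1 + 1 / 32)) := by
          gcongr
      _ ≤ 3 * X := by norm_num; linarith
  -- `E₀ ≥ 2 log(3X+1)`
  have hElog : 2 * Real.log (3 * X + 1) ≤ E₀ := by
    have h1 : Real.log (3 * X + 1) ≤ 3 * Real.log X := by
      have e : Real.log (X ^ 3) = 3 * Real.log X := by
        rw [Real.log_pow]; norm_num
      rw [← e]
      exact Real.log_le_log (by linarith) (three_mul_add_one_le_cube hX3)
    have h2 : 6 * Real.log X ≤ 36 * Real.log X ^ 2 := by
      have h3 : 0 ≤ 6 * Real.log X * (6 * Real.log X - 1) :=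
        mul_nonneg (by positivity) (by linarith)
      have h4 : 6 * Real.log X * (6 * Real.log X - 1) =
          36 * Real.log X ^ 2 - 6 * Real.log X := by ring
      linarith
    linarith
  -- the finite set of integers in `[X, 2X]`
  set S := Finset.Icc ⌈X⌉₊ ⌊2 * X⌋₊ with hS
  have hSmem : ∀ n ∈ S, X ≤ (n : ℝ) ∧ (n : ℝ) ≤ 2 * X := by
    intro n hn
    rw [hS, Finset.mem_Icc] at hn
    exact ⟨Nat.ceil_le.1 hn.1, (Nat.le_floor_iff (by positivity)).1 hn.2⟩
  -- Step A: `π`-exceptional integers are `ψ`-exceptional at level `E₀`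
  have hsubset : (S.filter fun x : ℕ => 3 * y * Real.exp (-(Real.log x) ^ (1 / 4 : ℝ)) <
        |(Nat.primeCounting ⌊(x : ℝ) + y⌋₊ : ℝ) - (Nat.primeCounting x : ℝ) - y / Real.log x|) ⊆
      S.filter (fun n : ℕ => E₀ < |ψ ((n : ℝ) + y) - ψ n - y|) := by
    intro n hn
    rw [Finset.mem_filter] at hn ⊢
    refine ⟨hn.1, ?_⟩
    obtain ⟨hnX, hn2X⟩ := hSmem n hn.1
    by_contra hle
    push Not at hle
    have h1 := abs_pi_window_le_of_abs_psi_le (hX3.trans hnX) hy0.le hle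
    have h2 := window_bookkeeping hX3 hη100 hi hii hy215 hy2 hnX hn2X
    linarith [hn.2]
  -- Step B: Chebyshev over the `ψ`-exceptional integers
  have hcore := card_exceptional_mul_le (S := S) (E := E₀) (K := K) hX1 hδ0 hy0 hyX hSmem hKspec
    hElog
  -- Step C: the mean-square input on `[X, 3X]`
  have hI : (∫ v in X..(2 * X + 1) * (1 + δ) ^ K, (ψ (v * (1 + δ)) - ψ v - δ * v) ^ 2) ≤
      C₉ * δ ^ 2 * X ^ 3 * Real.exp (-3 * Real.log X ^ (1 / 4 : ℝ)) := by
    have h8X := h8 X hX8 δ le_rfl hδ100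
    have hmono : (∫ v in X..(2 * X + 1) * (1 + δ) ^ K, (ψ (v * (1 + δ)) - ψ v - δ * v) ^ 2) ≤
        ∫ v in X..3 * X, (ψ (v * (1 + δ)) - ψ v - δ * v) ^ 2 := by
      refine intervalIntegral.integral_mono_interval le_rfl ?_ hX₁
        (Filter.Eventually.of_forall fun v => sq_nonneg _)
        (intervalIntegrable_sq_window (by linarith) hX0.le (by linarith))
      have : (1 : ℝ) ≤ (1 + δ) ^ K := one_le_pow₀ (by linarith)
      exact le_trans (by linarith) (le_mul_of_one_le_right (by linarith) this)
    have hcongr : (∫ v in X..3 * X, (ψ (v * (1 + δ)) - ψ v - δ * v) ^ 2) =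
        ∫ x in X..3 * X, (ψ (x + δ * x) - ψ x - δ * x) ^ 2 := by
      refine intervalIntegral.integral_congr fun v _ => ?_
      show (ψ (v * (1 + δ)) - ψ v - δ * v) ^ 2 = (ψ (v + δ * v) - ψ v - δ * v) ^ 2
      rw [show v * (1 + δ) = v + δ * v by ring]
    have hnn : 0 ≤ δ ^ 2 * X ^ 3 * Real.exp (-3 * Real.log X ^ (1 / 4 : ℝ)) := by positivity
    calc (∫ v in X..(2 * X + 1) * (1 + δ) ^ K, (ψ (v * (1 + δ)) - ψ v - δ * v) ^ 2)
        ≤ ∫ x in X..3 * X, (ψ (x + δ * x) - ψ x - δ * x) ^ 2 := hmono.trans hcongr.le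
      _ ≤ C₈ * δ ^ 2 * X ^ 3 * Real.exp (-3 * Real.log X ^ (1 / 4 : ℝ)) := h8X
      _ = C₈ * (δ ^ 2 * X ^ 3 * Real.exp (-3 * Real.log X ^ (1 / 4 : ℝ))) := by ring
      _ ≤ C₉ * (δ ^ 2 * X ^ 3 * Real.exp (-3 * Real.log X ^ (1 / 4 : ℝ))) :=
          mul_le_mul_of_nonneg_right hC₈9 hnn
      _ = C₉ * δ ^ 2 * X ^ 3 * Real.exp (-3 * Real.log X ^ (1 / 4 : ℝ)) := by ring
  -- Step D: bookkeeping
  have hfinal := count_bookkeeping (Nat.cast_nonneg _) hy0 hX1 hδ0 (by linarith) hcore hI hK2y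
    h16δX hE₀ hML
  calc ((S.filter fun x : ℕ => 3 * y * Real.exp (-(Real.log x) ^ (1 / 4 : ℝ)) <
          |(Nat.primeCounting ⌊(x : ℝ) + y⌋₊ : ℝ) - (Nat.primeCounting x : ℝ) - y / Real.log x|).card
        : ℝ)
      ≤ ((S.filter (fun n : ℕ => E₀ < |ψ ((n : ℝ) + y) - ψ n - y|)).card : ℝ) :=
        Nat.cast_le.2 (Finset.card_le_card hsubset)
    _ ≤ 64 * Real.exp 2 * C₉ * X * Real.exp (-Real.log X ^ (1 / 4 : ℝ)) := hfinal

end GuthMaynardAlmostAll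

/-- **Guth–Maynard 2026, Corollary 1.4 from the mean-square estimate (13.2):**
`GuthMaynard2026_psiMeanSquareShort → GuthMaynard2026_corollary_1_4` (re-export of
`GuthMaynardAlmostAll.corollary_1_4_of_psiMeanSquareShort` at the file-path namespace). NOT
RH-BEARING: primes in almost all short intervals `[x, x + x^{2/15+ε}]`.
[cite: GuthMaynard2026, Corollary 1.4 and §13.2] -/
theorem GuthMaynard2026_corollary_1_4_of_psiMeanSquareShort
    (h : GuthMaynard2026_psiMeanSquareShort) : GuthMaynard2026_corollary_1_4 :=
  GuthMaynardAlmostAll.corollary_1_4_of_psiMeanSquareShort h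

end Literature.NumberTheory.LFunctions

end
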